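import Mathlib
import HarnessLib
import Summits.HubbardSuperconductivity.HubbardSuperconductivity.Theses.JosephsonMirror
import Summits.HubbardSuperconductivity.HubbardSuperconductivity.Theorems.JosephsonMirrorJmCuspDedouble
import Summits.HubbardSuperconductivity.HubbardSuperconductivity.Theorems.JosephsonMirrorJmCuspAmgmConverse
import Summits.HubbardSuperconductivity.HubbardSuperconductivity.Theorems.JosephsonMirrorJmCuspOrderGivesCusp
import Summits.HubbardSuperconductivity.HubbardSuperconductivity.Theorems.JosephsonMirrorJmCuspTranscendentalSquarefree
import Summits.HubbardSuperconductivity.HubbardSuperconductivity.Theorems.JosephsonMirrorJmInterchangeExactResidues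

/-!
# Line `Sketch` — lead skeleton for crux `JmCusp` (stmt-HubbardSuperconductivity-2228), rev 7

Lead-owned copy of the checked skeleton `Cruxes/JmCusp/SketchIdeator1.lean` (union of the two round-1
crux cards `dedouble-zero-mode-cusp`, `galois-transport-simplicity`); lead seats
prover-line-stmt-HubbardSuperconductivity-2228-0 (cycle 1, revs 1–5), -c1-0 (cycle 2, rev 6) and -c2-0 (cycle 3, rev 7:
§ NORMAL FORM OF THE RESIDUAL at the end — the open stub is, up to constants, EXACTLY the crux, and clause (i) is
exactly zero-excess `d`-wave pair order at `(U, δ)`; landed as `Theorems/JosephsonMirrorJmCuspNormalForm.lean`).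

State (revs 6–7): every stub except the OPEN CORE `stub_core` is LANDED in the tree (`--supports stmt-2228`,
namespace `Summit.….Theorems.JosephsonMirror`) and is discharged below BY its tree theorem — no `sorry`
outside `stub_core`:
* `stub_dedouble` — `Theorems/JosephsonMirrorJmCuspDedouble.lean` (p104353): `ZeroModeCusp ⇒ JosephsonGain`
  (the mirror is removable), fed by `stub_gainAbstract` (p103116), `stub_sectorGap` (p102649),
  `stub_deformedGroundState` (p103206).
* `stub_amgm_converse` — `Theorems/JosephsonMirrorJmCuspAmgmConverse.lean` (p104472): `JosephsonGain ⇒ TwoSectorCusp`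
  (Kronecker AM–GM ceiling: nothing is lost by de-doubling, up to constants and the choice of sector/ordering).
* `stub_orderGivesCusp` — `Theorems/JosephsonMirrorJmCuspOrderGivesCusp.lean` (p103303): raising pair order of the
  `(N_L − 2, 0)` floor ⇒ `ZeroModeCusp` for every `g₀` (so ORDER ⇒ C⁺(i) ⇒ JmCusp(i): the sandwich
  `JmCusp_of_order_and_simple` below is kernel-checked with NO sorry).
* `stub_transcendental_squarefree` — `Theorems/JosephsonMirrorJmCuspTranscendentalSquarefree.lean` (p102614):
  the algebraic engine of the simplicity card.
* `stub_core` — the TRANSFER TARGET C⁺ itself: `∃ (U, δ, a', g₀), ZeroModeCusp ∧ Simplicity`. This is the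
  OPEN core of the crux (single-layer zero-mode d-wave cusp = the shared open number `m₊ > 0`, plus eventual
  simplicity); crux-sized (it is clause (i) de-doubled — equivalent to it up to constants by `stub_dedouble` /
  `stub_amgm_converse` — and clause (ii) verbatim); registered so that the composition is closed modulo stubs
  and the census names exactly what is crux-sized. Nobody is briefed on it; the lead hands it back (`promote-stub`).

All stub statements are DEF-FREE (the `def`s below are unfolded in them) so that `--supports` files prove
them by name + signature.

Composition: `JmCusp_of : JmCusp := JmCusp_iff_gain_and_simple.2 (gain_and_simple_of_transfer stub_core)`,
kernel-checked modulo `stub_core` (the only theorem concluding `JmCusp` by name).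
-/

namespace Summit.HubbardSuperconductivity.HubbardSuperconductivity.Cruxes.JmCusp.Lines.Sketch

open Summit.HubbardSuperconductivity.HubbardSuperconductivity.Theses.JosephsonMirror
open scoped Matrix

set_option linter.dupNamespace false

/-- JmCusp (i), verbatim: uniform linear Josephson gain of the window double at `(U, δ)` with
constant `a` on `(0, J₀]`. -/
def JosephsonGain (U δ a J₀ : ℝ) : Prop :=
  ∀ J ∈ Set.Ioc (0:ℝ) J₀, ∃ L₀ : ℕ, ∀ (L : ℕ) [NeZero L], Even L → L₀ ≤ L → (let ι : Type := Finset (Literature.MathematicalPhysics.QuantumLattice.Orb (Literature.MathematicalPhysics.QuantumLattice.FermionTorus 2 L)); let N : ℕ := 2 * ⌊(1 - δ) * (L : ℝ) ^ 2 / 2⌋₊; let H : Matrix ι ι ℂ := Literature.MathematicalPhysics.QuantumLattice.hubbardTorus 2 L 1 U; let μ : ℝ := (H.minEnergyOn (Literature.MathematicalPhysics.QuantumLattice.szSector N 0) - H.minEnergyOn (Literature.MathematicalPhysics.QuantumLattice.szSector (N - 2) 0)) / 2; let A : Matrix ι ι ℂ := Literature.MathematicalPhysics.QuantumLattice.hubbardTorusWith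 2 L 1 U μ; let D : Matrix ι ι ℂ := ((L : ℂ))⁻¹ • Literature.MathematicalPhysics.QuantumLattice.pairField Literature.MathematicalPhysics.QuantumLattice.dWaveFormFactor L; let Hd : ℝ → Matrix (ι × ι) (ι × ι) ℂ := fun J => Matrix.kroneckerMap (fun a b : ℂ => a * b) A 1 + Matrix.kroneckerMap (fun a b : ℂ => a * b) 1 (Matrix.transpose A) - (J : ℂ) • (Matrix.kroneckerMap (fun a b : ℂ => a * b) D (Matrix.transpose (Matrix.conjTranspose D)) + Matrix.kroneckerMap (fun a b : ℂ => a * b) (Matrix.conjTranspose D) (Matrix.transpose D)); let good : ι × ι → Prop := fun p => ((p.1.card = N ∧ p.2.card = N) ∨ (p.1.card = N - 2 ∧ p.2.card = N - 2)) ∧ (p.1.filter (fun o => (ofLex o).2 = 0)).card = (p.1.filter (fun o => (ofLex o).2 = 1)).card ∧ (p.2.filter (fun o => (ofLex o).2 = 0)).card = (p.2.filter (fun o => (ofLex o).2 = 1)).card; let S : Submodule ℂ (ι × ι → ℂ) := ⨅ (p : ι × ι) (_ : ¬ good p), LinearMap.ker (LinearMap.proj (R := ℂ) (φ := fun _ :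 ι × ι => ℂ) p); let E : ℝ → ℝ := fun J => (Hd J).minEnergyOn S; a * J * (L : ℝ) ^ 2 ≤ E 0 - E J)

/-- JmCusp (ii), verbatim: eventual simplicity of the `(N_L, S^z = 0)` ground state. -/
def Simplicity (U δ : ℝ) : Prop :=
  ∃ L₀ : ℕ, ∀ (L : ℕ), Even L → L₀ ≤ L → ∀ φ φ' : Literature.MathematicalPhysics.QuantumLattice.Fock (Literature.MathematicalPhysics.QuantumLattice.Orb (Literature.MathematicalPhysics.QuantumLattice.FermionTorus 2 L)), Literature.MathematicalPhysics.QuantumLattice.IsGroundStateInSector (Literature.MathematicalPhysics.QuantumLattice.hubbardTorus 2 L 1 U) (2 * ⌊(1 - δ) * (L : ℝ) ^ 2 / 2⌋₊) 0 φ → Literature.MathematicalPhysics.QuantumLattice.IsGroundStateInSector (Literature.MathematicalPhysics.QuantumLattice.hubbardTorus 2 L 1 U) (2 * ⌊(1 - δ) * (L : ℝ) ^ 2 / 2⌋₊) 0 φ' → ∃ c : ℂ, φ' = c • φ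

/-- The crux is literally `∃ (U δ a J₀), gain ∧ simplicity` (syntactic check). -/
theorem JmCusp_iff_gain_and_simple :
    JmCusp ↔ ∃ U : ℝ, 0 < U ∧ ∃ δ ∈ Set.Ioo (0:ℝ) (1 / 2), ∃ a : ℝ, 0 < a ∧ ∃ J₀ : ℝ, 0 < J₀ ∧
      JosephsonGain U δ a J₀ ∧ Simplicity U δ :=
  Iff.rfl

/-- TRANSFER TARGET `C⁺_def` (card `dedouble-zero-mode-cusp`): the single-layer, canonical,
number-conserving ZERO-MODE d-WAVE BCS DEFORMATION has a linear cusp — for every small `g > 0`,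
eventually in even `L`, deforming `hubbardTorus 2 L 1 U` by `-(g/L²)·Δ Δᴴ` (`Δ = pairField dWaveFormFactor L`,
an annihilator, so `Δ Δᴴ` preserves the sector) lowers the `(N_L - 2, S^z = 0)` sector ground energy by at
least `a·g·L²`. One layer, all symmetries of the layer intact, no chemical potential, no tensor packaging. -/
def ZeroModeCusp (U δ a g₀ : ℝ) : Prop :=
  ∀ g ∈ Set.Ioc (0:ℝ) g₀, ∃ L₀ : ℕ, ∀ (L : ℕ) [NeZero L], Even L → L₀ ≤ L → (let ι : Type := Finset (Literature.MathematicalPhysics.QuantumLattice.Orb (Literature.MathematicalPhysics.QuantumLattice.FermionTorus 2 L)); let N : ℕ := 2 * ⌊(1 - δ) * (L : ℝ) ^ 2 / 2⌋₊; let H : Matrix ι ι ℂ := Literature.MathematicalPhysics.QuantumLattice.hubbardTorus 2 L 1 U; let P : Matrix ι ι ℂ := Literature.MathematicalPhysics.QuantumLattice.pairField Literature.MathematicalPhysics.QuantumLattice.dWaveFormFactor L; a * g * (L : ℝ) ^ 2 ≤ H.minEnergyOn (Literature.MathematicalPhysics.QuantumLattice.szSector (N - 2) 0) - (H - ((g /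 (L : ℝ) ^ 2 : ℝ) : ℂ) • (P * Pᴴ)).minEnergyOn (Literature.MathematicalPhysics.QuantumLattice.szSector (N - 2) 0))

/-- FIRST LEMMA of card `dedouble-zero-mode-cusp` (the de-doubling inequality; provable now, M-sized,
reusing the trial-state energy identity of `Theorems/…jmPairBridgeGivesGain_proof`): the single-layer
zero-mode cusp with constant `a'` gives the Josephson gain with `a = a'²/(2(a'+32))`
(`32 ≥ ‖Δ‖²/L⁴`; trial `ψ = (χ⊗χ̄ + φ_g⊗φ̄_g)/√2`, `φ_g` the deformed ground state at
`g = J·a'/(a'+32)`, `χ = Δᴴφ_g/‖Δᴴφ_g‖`; the coherence ratio is automatic from `‖Δ‖ ≤ √32·L²`). -/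
theorem stub_dedouble (U δ a' g₀ : ℝ) (hδ : δ ∈ Set.Ioo (0:ℝ) (1 / 2)) (ha : 0 < a') :
    (∀ g ∈ Set.Ioc (0:ℝ) g₀, ∃ L₀ : ℕ, ∀ (L : ℕ) [NeZero L], Even L → L₀ ≤ L → (let ι : Type := Finset (Literature.MathematicalPhysics.QuantumLattice.Orb (Literature.MathematicalPhysics.QuantumLattice.FermionTorus 2 L)); let N : ℕ := 2 * ⌊(1 - δ) * (L : ℝ) ^ 2 / 2⌋₊; let H : Matrix ι ι ℂ := Literature.MathematicalPhysics.QuantumLattice.hubbardTorus 2 L 1 U; let P : Matrix ι ι ℂ := Literature.MathematicalPhysics.QuantumLattice.pairField Literature.MathematicalPhysics.QuantumLattice.dWaveFormFactor L; a' * g * (L : ℝ) ^ 2 ≤ H.minEnergyOn (Literature.MathematicalPhysics.QuantumLattice.szSector (N - 2) 0) - (H - ((g / (L : ℝ) ^ 2 : ℝ) : ℂ) • (P * Pᴴ)).minEnergyOn (Literature.MathematicalPhysics.QuantumLattice.szSector (N - 2) 0))) →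
    ∀ J ∈ Set.Ioc (0:ℝ) g₀, ∃ L₀ : ℕ, ∀ (L : ℕ) [NeZero L], Even L → L₀ ≤ L → (let ι : Type := Finset (Literature.MathematicalPhysics.QuantumLattice.Orb (Literature.MathematicalPhysics.QuantumLattice.FermionTorus 2 L)); let N : ℕ := 2 * ⌊(1 - δ) * (L : ℝ) ^ 2 / 2⌋₊; let H : Matrix ι ι ℂ := Literature.MathematicalPhysics.QuantumLattice.hubbardTorus 2 L 1 U; let μ : ℝ := (H.minEnergyOn (Literature.MathematicalPhysics.QuantumLattice.szSector N 0) - H.minEnergyOn (Literature.MathematicalPhysics.QuantumLattice.szSector (N - 2) 0)) / 2; let A : Matrix ι ι ℂ := Literature.MathematicalPhysics.QuantumLattice.hubbardTorusWith 2 L 1 U μ; let D : Matrix ι ι ℂ := ((L : ℂ))⁻¹ • Literature.MathematicalPhysics.QuantumLattice.pairField Literature.MathematicalPhysics.QuantumLattice.dWaveFormFactor L; let Hd : ℝ → Matrix (ι × ι) (ι × ι) ℂ := fun J => Matrix.kroneckerMap (fun a b : ℂ => a * b) A 1 + Matrix.kroneckerMap (fun a b : ℂ => a * b) 1 (Matrix.transpose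 A) - (J : ℂ) • (Matrix.kroneckerMap (fun a b : ℂ => a * b) D (Matrix.transpose (Matrix.conjTranspose D)) + Matrix.kroneckerMap (fun a b : ℂ => a * b) (Matrix.conjTranspose D) (Matrix.transpose D)); let good : ι × ι → Prop := fun p => ((p.1.card = N ∧ p.2.card = N) ∨ (p.1.card = N - 2 ∧ p.2.card = N - 2)) ∧ (p.1.filter (fun o => (ofLex o).2 = 0)).card = (p.1.filter (fun o => (ofLex o).2 = 1)).card ∧ (p.2.filter (fun o => (ofLex o).2 = 0)).card = (p.2.filter (fun o => (ofLex o).2 = 1)).card; let S : Submodule ℂ (ι × ι → ℂ) := ⨅ (p : ι × ι) (_ : ¬ good p), LinearMap.ker (LinearMap.proj (R := ℂ) (φ := fun _ : ι × ι => ℂ) p); let E : ℝ → ℝ := fun J => (Hd J).minEnergyOn S; a' ^ 2 / (2 * (a' + 32)) * J * (L : ℝ) ^ 2 ≤ E 0 - E J) :=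
  _root_.Summit.HubbardSuperconductivity.HubbardSuperconductivity.Theorems.JosephsonMirror.stub_dedouble U δ a' g₀ hδ ha

/-- HELPER STUB feeding `stub_dedouble` (lead reshaping, cycle 1): the ABSTRACT de-doubling bound for the
window double `H(J) = A⊗1 + 1⊗Aᵀ − J(D⊗D̄ + Dᴴ⊗D̄ᴴ)` on the window `S` (pairs in a common block `P₁` or `P₂`,
`A ≥ a` on each block): for ANY unit trial pair `u` (supported in `P₁`), `w` (supported in `P₂`) and `J ≥ 0`,
`J |⟨w, D u⟩|² − (Re⟨u,Au⟩ − a) − (Re⟨w,Aw⟩ − a) ≤ E(0) − E(J)` — the generalisation of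
`Theorems/JosephsonMirrorWindowDouble.gain_le_minEnergyOn_sub` from eigenvector pairs to arbitrary trial pairs
(same proof: `E(0) ≥ 2a` column/row-wise; `E(J) ≤` Rayleigh quotient of `(u⊗ū + w⊗w̄)/√2`, whose `H₀`-part is
`Re⟨u,Au⟩ + Re⟨w,Aw⟩` because `u ⊥ w`, and whose `K`-part is `≥ |⟨w,Du⟩|²`). -/
theorem stub_gainAbstract {ι : Type} [Fintype ι] [DecidableEq ι]
    (A D : Matrix ι ι ℂ) (hA : A.IsHermitian)
    (P₁ P₂ : ι → Prop) (h12 : ∀ s, P₁ s → ¬ P₂ s)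
    (good : ι × ι → Prop) (hgood : ∀ s t, good (s, t) → (P₁ s ∧ P₁ t) ∨ (P₂ s ∧ P₂ t))
    (hgood₁ : ∀ s t, P₁ s → P₁ t → good (s, t)) (hgood₂ : ∀ s t, P₂ s → P₂ t → good (s, t))
    (S : Submodule ℂ (ι × ι → ℂ)) (hS : ∀ ψ, ψ ∈ S ↔ ∀ p, ¬ good p → ψ p = 0)
    (a : ℝ)
    (hA₁ : ∀ v : ι → ℂ, (∀ s, ¬ P₁ s → v s = 0) → a * (star v ⬝ᵥ v).re ≤ (star v ⬝ᵥ A.mulVec v).re)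
    (hA₂ : ∀ v : ι → ℂ, (∀ s, ¬ P₂ s → v s = 0) → a * (star v ⬝ᵥ v).re ≤ (star v ⬝ᵥ A.mulVec v).re)
    (u w : ι → ℂ) (huP : ∀ s, ¬ P₁ s → u s = 0) (hwP : ∀ s, ¬ P₂ s → w s = 0)
    (hu1 : star u ⬝ᵥ u = 1) (hw1 : star w ⬝ᵥ w = 1) {J : ℝ} (hJ : 0 ≤ J) :
    J * ‖star w ⬝ᵥ D.mulVec u‖ ^ 2 - ((star u ⬝ᵥ A.mulVec u).re - a) - ((star w ⬝ᵥ A.mulVec w).re - a) ≤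
      (Matrix.kroneckerMap (fun a b : ℂ => a * b) A 1 + Matrix.kroneckerMap (fun a b : ℂ => a * b) 1 Aᵀ -
          ((0 : ℝ) : ℂ) • (Matrix.kroneckerMap (fun a b : ℂ => a * b) D Dᴴᵀ +
            Matrix.kroneckerMap (fun a b : ℂ => a * b) Dᴴ Dᵀ)).minEnergyOn S -
        (Matrix.kroneckerMap (fun a b : ℂ => a * b) A 1 + Matrix.kroneckerMap (fun a b : ℂ => a * b) 1 Aᵀ -
          (J : ℂ) • (Matrix.kroneckerMap (fun a b : ℂ => a * b) D Dᴴᵀ +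
            Matrix.kroneckerMap (fun a b : ℂ => a * b) Dᴴ Dᵀ)).minEnergyOn S :=
  _root_.Summit.HubbardSuperconductivity.HubbardSuperconductivity.Theorems.JosephsonMirror.stub_gainAbstract A D hA P₁ P₂ h12 good hgood hgood₁ hgood₂ S hS a hA₁ hA₂ u w huP hwP hu1 hw1 hJ

/-- HELPER STUB feeding `stub_dedouble` (lead reshaping, cycle 1): on the torus the `(N_L − 2, S^z = 0)`
sector floor exceeds the `(N_L, S^z = 0)` floor by at most a constant `C(U, δ)`, uniformly in large `L`
(remove two electrons from a ground state: `groundEnergyAt_pred_le` twice, degree `≤ 4`, `N_L ≥ L²/4`,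
and `groundEnergyAt (2n) = minEnergyOn (szSector (2n) 0)` by `SU(2)`). -/
theorem stub_sectorGap (U δ : ℝ) (hδ : δ ∈ Set.Ioo (0:ℝ) (1 / 2)) :
    ∃ C : ℝ, ∃ L₀ : ℕ, ∀ (L : ℕ) [NeZero L], L₀ ≤ L →
      (Literature.MathematicalPhysics.QuantumLattice.hubbardTorus 2 L 1 U).minEnergyOn
          (Literature.MathematicalPhysics.QuantumLattice.szSector (2 * ⌊(1 - δ) * (L : ℝ) ^ 2 / 2⌋₊ - 2) 0) ≤
        (Literature.MathematicalPhysics.QuantumLattice.hubbardTorus 2 L 1 U).minEnergyOn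
          (Literature.MathematicalPhysics.QuantumLattice.szSector (2 * ⌊(1 - δ) * (L : ℝ) ^ 2 / 2⌋₊) 0) + C :=
  _root_.Summit.HubbardSuperconductivity.HubbardSuperconductivity.Theorems.JosephsonMirror.stub_sectorGap U δ hδ

/-- HELPER STUB feeding `stub_dedouble` (lead reshaping, cycle 1): the deformed layer
`H_c = hubbardTorus 2 L 1 U − c Δ_d Δ_dᴴ` (real `c`) leaves the coordinate sector `szSector (2k) 0` invariant
and has a normalised eigenvector there with eigenvalue its sector energy (`sector_groundState`; `Δ_d Δ_dᴴ`
preserves the sector because `Δ_dᴴ` raises and `Δ_d` lowers the particle number by two at fixed `S^z`).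
Landed with the norm bookkeeping `‖Δ_d‖² ≤ 32L⁴`, `‖[H, Δ_dᴴ]‖ ≤ K L²` as riders. -/
theorem stub_deformedGroundState {L : ℕ} [NeZero L] (U c : ℝ) {k : ℕ} (hk : k ≤ L ^ 2) :
    ∃ φ : Literature.MathematicalPhysics.QuantumLattice.Fock (Literature.MathematicalPhysics.QuantumLattice.Orb (Literature.MathematicalPhysics.QuantumLattice.FermionTorus 2 L)),
      φ ∈ Literature.MathematicalPhysics.QuantumLattice.szSector (2 * k) 0 ∧ star φ ⬝ᵥ φ = 1 ∧
      (Literature.MathematicalPhysics.QuantumLattice.hubbardTorus 2 L 1 U - (c : ℂ) •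
          (Literature.MathematicalPhysics.QuantumLattice.pairField Literature.MathematicalPhysics.QuantumLattice.dWaveFormFactor L *
            (Literature.MathematicalPhysics.QuantumLattice.pairField Literature.MathematicalPhysics.QuantumLattice.dWaveFormFactor L)ᴴ)).mulVec φ =
        (((Literature.MathematicalPhysics.QuantumLattice.hubbardTorus 2 L 1 U - (c : ℂ) •
            (Literature.MathematicalPhysics.QuantumLattice.pairField Literature.MathematicalPhysics.QuantumLattice.dWaveFormFactor L *
              (Literature.MathematicalPhysics.QuantumLattice.pairField Literature.MathematicalPhysics.QuantumLattice.dWaveFormFactor L)ᴴ)).minEnergyOn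
              (Literature.MathematicalPhysics.QuantumLattice.szSector (2 * k) 0) : ℝ) : ℂ) • φ :=
  _root_.Summit.HubbardSuperconductivity.HubbardSuperconductivity.Theorems.JosephsonMirror.stub_deformedGroundState U c hk

/-- GLUE (kernel-checked modulo `stub_dedouble`): the transfer target `C⁺ := ZeroModeCusp ∧ Simplicity`
at one `(U, δ)` gives the two clauses of the crux (`JosephsonGain ∧ Simplicity`, i.e. `JmCusp` up to
`JmCusp_iff_gain_and_simple`); the by-name conclusion is `JmCusp_of` at the end of the file. The stubs are
stated with the `def`s unfolded (so that landed `--supports` files can prove them by name + signature without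
importing this workfile); here they are folded back by `Iff.rfl`. -/
theorem gain_and_simple_of_transfer
    (h : ∃ U : ℝ, 0 < U ∧ ∃ δ ∈ Set.Ioo (0:ℝ) (1 / 2), ∃ a' : ℝ, 0 < a' ∧ ∃ g₀ : ℝ, 0 < g₀ ∧
      ZeroModeCusp U δ a' g₀ ∧ Simplicity U δ) :
    ∃ U : ℝ, 0 < U ∧ ∃ δ ∈ Set.Ioo (0:ℝ) (1 / 2), ∃ a : ℝ, 0 < a ∧ ∃ J₀ : ℝ, 0 < J₀ ∧
      JosephsonGain U δ a J₀ ∧ Simplicity U δ := by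
  obtain ⟨U, hU, δ, hδ, a', ha', g₀, hg₀, hC, hS⟩ := h
  exact ⟨U, hU, δ, hδ, a' ^ 2 / (2 * (a' + 32)), by positivity, g₀, hg₀,
    stub_dedouble U δ a' g₀ hδ ha' hC, hS⟩

/-- CONVERSE direction (card `dedouble-zero-mode-cusp`, the Kronecker AM–GM ceiling
`K ≤ DDᴴ⊗1 + 1⊗D̄ᴴD̄`, i.e. the first step of `JmFreeLayersNoCusp`): the Josephson gain never exceeds the
sum of the two orderings' single-layer deformation gains in the better of the two window sectors — so nothing
is lost by de-doubling. -/
def TwoSectorCusp (U δ a J₀ : ℝ) : Prop :=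
  ∀ J ∈ Set.Ioc (0:ℝ) J₀, ∃ L₀ : ℕ, ∀ (L : ℕ) [NeZero L], Even L → L₀ ≤ L → (let ι : Type := Finset (Literature.MathematicalPhysics.QuantumLattice.Orb (Literature.MathematicalPhysics.QuantumLattice.FermionTorus 2 L)); let N : ℕ := 2 * ⌊(1 - δ) * (L : ℝ) ^ 2 / 2⌋₊; let H : Matrix ι ι ℂ := Literature.MathematicalPhysics.QuantumLattice.hubbardTorus 2 L 1 U; let P : Matrix ι ι ℂ := Literature.MathematicalPhysics.QuantumLattice.pairField Literature.MathematicalPhysics.QuantumLattice.dWaveFormFactor L; let c : ℂ := ((J / (L : ℝ) ^ 2 : ℝ) : ℂ); let G : ℕ → Matrix ι ι ℂ → ℝ := fun n Q => H.minEnergyOn (Literature.MathematicalPhysics.QuantumLattice.szSector n 0) - (H - c • Q).minEnergyOn (Literature.MathematicalPhysics.QuantumLattice.szSector n 0); a * J * (L : ℝ) ^ 2 ≤ (G N (P * Pᴴ) + G N (Pᴴ * P)) ⊔ (G (N - 2) (P * Pᴴ) + G (N - 2) (Pᴴ * P)))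

/-- CONVERSE stub: the Josephson gain is bounded by the two orderings' single-layer deformation gains
(Kronecker AM–GM `D⊗D̄ + Dᴴ⊗D̄ᴴ ≤ DDᴴ⊗1 + 1⊗D̄ᴴD̄`, block decomposition of the window, `E(0) ≤ 2a`). -/
theorem stub_amgm_converse (U δ a J₀ : ℝ) (hδ : δ ∈ Set.Ioo (0:ℝ) (1 / 2)) :
    (∀ J ∈ Set.Ioc (0:ℝ) J₀, ∃ L₀ : ℕ, ∀ (L : ℕ) [NeZero L], Even L → L₀ ≤ L → (let ι : Type := Finset (Literature.MathematicalPhysics.QuantumLattice.Orb (Literature.MathematicalPhysics.QuantumLattice.FermionTorus 2 L)); let N : ℕ := 2 * ⌊(1 - δ) * (L : ℝ) ^ 2 / 2⌋₊; let H : Matrix ι ι ℂ := Literature.MathematicalPhysics.QuantumLattice.hubbardTorus 2 L 1 U; let μ : ℝ := (H.minEnergyOn (Literature.MathematicalPhysics.QuantumLattice.szSector N 0) - H.minEnergyOn (Literature.MathematicalPhysics.QuantumLattice.szSector (N - 2) 0)) / 2; let A : Matrix ι ι ℂ := Literature.MathematicalPhysics.QuantumLattice.hubbardTorusWith 2 L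 1 U μ; let D : Matrix ι ι ℂ := ((L : ℂ))⁻¹ • Literature.MathematicalPhysics.QuantumLattice.pairField Literature.MathematicalPhysics.QuantumLattice.dWaveFormFactor L; let Hd : ℝ → Matrix (ι × ι) (ι × ι) ℂ := fun J => Matrix.kroneckerMap (fun a b : ℂ => a * b) A 1 + Matrix.kroneckerMap (fun a b : ℂ => a * b) 1 (Matrix.transpose A) - (J : ℂ) • (Matrix.kroneckerMap (fun a b : ℂ => a * b) D (Matrix.transpose (Matrix.conjTranspose D)) + Matrix.kroneckerMap (fun a b : ℂ => a * b) (Matrix.conjTranspose D) (Matrix.transpose D)); let good : ι × ι → Prop := fun p => ((p.1.card = N ∧ p.2.card = N) ∨ (p.1.card = N - 2 ∧ p.2.card = N - 2)) ∧ (p.1.filter (fun o => (ofLex o).2 = 0)).card = (p.1.filter (fun o => (ofLex o).2 = 1)).card ∧ (p.2.filter (fun o => (ofLex o).2 = 0)).card = (p.2.filter (fun o => (ofLex o).2 = 1)).card; let S : Submodule ℂ (ι × ι → ℂ) := ⨅ (p : ι × ι) (_ : ¬ good p), LinearMap.ker (LinearMap.proj (R := ℂ) (φ := fun _ : ι ×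 ι => ℂ) p); let E : ℝ → ℝ := fun J => (Hd J).minEnergyOn S; a * J * (L : ℝ) ^ 2 ≤ E 0 - E J)) →
    ∀ J ∈ Set.Ioc (0:ℝ) J₀, ∃ L₀ : ℕ, ∀ (L : ℕ) [NeZero L], Even L → L₀ ≤ L → (let ι : Type := Finset (Literature.MathematicalPhysics.QuantumLattice.Orb (Literature.MathematicalPhysics.QuantumLattice.FermionTorus 2 L)); let N : ℕ := 2 * ⌊(1 - δ) * (L : ℝ) ^ 2 / 2⌋₊; let H : Matrix ι ι ℂ := Literature.MathematicalPhysics.QuantumLattice.hubbardTorus 2 L 1 U; let P : Matrix ι ι ℂ := Literature.MathematicalPhysics.QuantumLattice.pairField Literature.MathematicalPhysics.QuantumLattice.dWaveFormFactor L; let c : ℂ := ((J / (L : ℝ) ^ 2 : ℝ) : ℂ); let G : ℕ → Matrix ι ι ℂ → ℝ := fun n Q => H.minEnergyOn (Literature.MathematicalPhysics.QuantumLattice.szSector n 0) - (H - c • Q).minEnergyOn (Literature.MathematicalPhysics.QuantumLattice.szSector n 0); a * J * (L : ℝ) ^ 2 ≤ (G N (P * Pᴴ) + G N (Pᴴ *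 P)) ⊔ (G (N - 2) (P * Pᴴ) + G (N - 2) (Pᴴ * P))) :=
  _root_.Summit.HubbardSuperconductivity.HubbardSuperconductivity.Theorems.JosephsonMirror.stub_amgm_converse U δ a J₀ hδ

/-- FIRST LEMMA of card `galois-transport-simplicity` (pure algebra, provable now): for an integer
pencil `T + U·D` (the Hubbard torus: `T` = hopping with entries in `0, 1, -1`, `D` = diagonal double
occupancy), if the characteristic polynomial over `ℤ[U]` of (a symmetry block of) the pencil is squarefree,
then at every TRANSCENDENTAL coupling `U` the specialised characteristic polynomial is squarefree, i.e. every
eigenvalue of that block — in particular its lowest — is simple. (Discriminant is a nonzero integer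
polynomial in `U`; it cannot vanish at a transcendental point.) -/
theorem stub_transcendental_squarefree {n : Type} [Fintype n] [DecidableEq n]
    (T D : Matrix n n ℤ) (U : ℝ) (hU : Transcendental ℚ U)
    (hsq : Squarefree (T.map (algebraMap ℤ (Polynomial ℤ)) +
      (Polynomial.X : Polynomial ℤ) • D.map (algebraMap ℤ (Polynomial ℤ))).charpoly) :
    Squarefree (T.map (Int.castRingHom ℝ) + U • D.map (Int.castRingHom ℝ)).charpoly :=
  _root_.Summit.HubbardSuperconductivity.HubbardSuperconductivity.Theorems.JosephsonMirror.stub_transcendental_squarefree T D U hU hsq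

/-- CALIBRATION STUB (registered 12:47Z cycle 1 via stub-add; LANDED p103303): finite-volume RAISING pair order of
the `(N_L − 2, S^z = 0)` floor (some unit ground state `ψ_L` with `‖Δ_dᴴ ψ_L‖² ≥ a' L⁴`, eventually in even `L`)
gives the zero-mode cusp `ZeroModeCusp U δ a' g₀` for EVERY `g₀` (variational principle with trial `ψ_L`). -/
theorem stub_orderGivesCusp :
    ∀ (U δ a' g₀ : ℝ), (∃ L₀ : ℕ, ∀ (L : ℕ) [NeZero L], Even L → L₀ ≤ L → ∃ ψ : Literature.MathematicalPhysics.QuantumLattice.Fock (Literature.MathematicalPhysics.QuantumLattice.Orb (Literature.MathematicalPhysics.QuantumLattice.FermionTorus 2 L)), Literature.MathematicalPhysics.QuantumLattice.IsGroundStateInSector (Literature.MathematicalPhysics.QuantumLattice.hubbardTorus 2 L 1 U) (2 * ⌊(1 - δ) * (L : ℝ) ^ 2 / 2⌋₊ - 2) 0 ψ ∧ star ψ ⬝ᵥ ψ = 1 ∧ a' * (L : ℝ) ^ 4 ≤ (star (Matrix.mulVec (Literature.MathematicalPhysics.QuantumLattice.pairField Literature.MathematicalPhysics.QuantumLattice.dWaveFormFactor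 L)ᴴ ψ) ⬝ᵥ (Matrix.mulVec (Literature.MathematicalPhysics.QuantumLattice.pairField Literature.MathematicalPhysics.QuantumLattice.dWaveFormFactor L)ᴴ ψ)).re) →
    ∀ g ∈ Set.Ioc (0:ℝ) g₀, ∃ L₀ : ℕ, ∀ (L : ℕ) [NeZero L], Even L → L₀ ≤ L → (let ι : Type := Finset (Literature.MathematicalPhysics.QuantumLattice.Orb (Literature.MathematicalPhysics.QuantumLattice.FermionTorus 2 L)); let N : ℕ := 2 * ⌊(1 - δ) * (L : ℝ) ^ 2 / 2⌋₊; let H : Matrix ι ι ℂ := Literature.MathematicalPhysics.QuantumLattice.hubbardTorus 2 L 1 U; let P : Matrix ι ι ℂ := Literature.MathematicalPhysics.QuantumLattice.pairField Literature.MathematicalPhysics.QuantumLattice.dWaveFormFactor L; a' * g * (L : ℝ) ^ 2 ≤ H.minEnergyOn (Literature.MathematicalPhysics.QuantumLattice.szSector (N - 2) 0) - (H - ((g / (L : ℝ) ^ 2 : ℝ) : ℂ) • (P * Pᴴ)).minEnergyOn (Literature.MathematicalPhysics.QuantumLattice.szSector (N - 2) 0)) :=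
  _root_.Summit.HubbardSuperconductivity.HubbardSuperconductivity.Theorems.JosephsonMirror.stub_orderGivesCusp

/-- THE OPEN CORE (transfer target C⁺ of line `Sketch`): some `(U, δ)` carries the single-layer
zero-mode d-wave cusp AND eventual simplicity of the `(N_L, S^z = 0)` ground floor. This is the crux's
physics (clause (i) de-doubled = the shared open number `m₊ > 0`; clause (ii) verbatim). Registered as a
stub only to make the composition closed modulo stubs; it is crux-sized and is NOT briefed to any worker. -/
theorem stub_core :
    ∃ U : ℝ, 0 < U ∧ ∃ δ ∈ Set.Ioo (0:ℝ) (1 / 2), ∃ a' : ℝ, 0 < a' ∧ ∃ g₀ : ℝ, 0 < g₀ ∧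
      (∀ g ∈ Set.Ioc (0:ℝ) g₀, ∃ L₀ : ℕ, ∀ (L : ℕ) [NeZero L], Even L → L₀ ≤ L → (let ι : Type := Finset (Literature.MathematicalPhysics.QuantumLattice.Orb (Literature.MathematicalPhysics.QuantumLattice.FermionTorus 2 L)); let N : ℕ := 2 * ⌊(1 - δ) * (L : ℝ) ^ 2 / 2⌋₊; let H : Matrix ι ι ℂ := Literature.MathematicalPhysics.QuantumLattice.hubbardTorus 2 L 1 U; let P : Matrix ι ι ℂ := Literature.MathematicalPhysics.QuantumLattice.pairField Literature.MathematicalPhysics.QuantumLattice.dWaveFormFactor L; a' * g * (L : ℝ) ^ 2 ≤ H.minEnergyOn (Literature.MathematicalPhysics.QuantumLattice.szSector (N - 2) 0) - (H - ((g / (L : ℝ) ^ 2 : ℝ) : ℂ) • (P * Pᴴ)).minEnergyOn (Literature.MathematicalPhysics.QuantumLattice.szSector (N - 2) 0))) ∧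
      (∃ L₀ : ℕ, ∀ (L : ℕ), Even L → L₀ ≤ L → ∀ φ φ' : Literature.MathematicalPhysics.QuantumLattice.Fock (Literature.MathematicalPhysics.QuantumLattice.Orb (Literature.MathematicalPhysics.QuantumLattice.FermionTorus 2 L)), Literature.MathematicalPhysics.QuantumLattice.IsGroundStateInSector (Literature.MathematicalPhysics.QuantumLattice.hubbardTorus 2 L 1 U) (2 * ⌊(1 - δ) * (L : ℝ) ^ 2 / 2⌋₊) 0 φ → Literature.MathematicalPhysics.QuantumLattice.IsGroundStateInSector (Literature.MathematicalPhysics.QuantumLattice.hubbardTorus 2 L 1 U) (2 * ⌊(1 - δ) * (L : ℝ) ^ 2 / 2⌋₊) 0 φ' → ∃ c : ℂ, φ' = c • φ) := by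
  sorry

/-- COMPOSITION (closed modulo the stubs, the ONLY theorem of this file concluding the crux): the line
concludes the crux `JmCusp` BY NAME from `stub_core` through `stub_dedouble`. -/
theorem JmCusp_of : JmCusp :=
  JmCusp_iff_gain_and_simple.2 (gain_and_simple_of_transfer stub_core)

/-- THE SANDWICH (kernel-checked, NO sorry): floor pair order at some `(U, δ)` together with eventual
simplicity there already gives the crux (in its once-unfolded form `∃ …, JosephsonGain ∧ Simplicity`) — ORDER ⇒ C⁺(i) (`stub_orderGivesCusp`) ⇒ JmCusp(i) (`stub_dedouble`),
clause (ii) carried verbatim. So the line's transfer target C⁺ sits between S-type finite-volume order and the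
crux, and is no harder than 'pair order of ONE ground-state sequence + simplicity'. -/
theorem JmCusp_of_order_and_simple
    (h : ∃ U : ℝ, 0 < U ∧ ∃ δ ∈ Set.Ioo (0:ℝ) (1 / 2), ∃ a' : ℝ, 0 < a' ∧
      (∃ L₀ : ℕ, ∀ (L : ℕ) [NeZero L], Even L → L₀ ≤ L → ∃ ψ : Literature.MathematicalPhysics.QuantumLattice.Fock (Literature.MathematicalPhysics.QuantumLattice.Orb (Literature.MathematicalPhysics.QuantumLattice.FermionTorus 2 L)), Literature.MathematicalPhysics.QuantumLattice.IsGroundStateInSector (Literature.MathematicalPhysics.QuantumLattice.hubbardTorus 2 L 1 U) (2 * ⌊(1 - δ) * (L : ℝ) ^ 2 / 2⌋₊ - 2) 0 ψ ∧ star ψ ⬝ᵥ ψ = 1 ∧ a' * (L : ℝ) ^ 4 ≤ (star (Matrix.mulVec (Literature.MathematicalPhysics.QuantumLattice.pairField Literature.MathematicalPhysics.QuantumLattice.dWaveFormFactor L)ᴴ ψ) ⬝ᵥ (Matrix.mulVec (Literature.MathematicalPhysics.QuantumLattice.pairField Literature.MathematicalPhysics.QuantumLattice.dWaveFormFactor L)ᴴ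 ψ)).re) ∧
      Simplicity U δ) :
    ∃ U : ℝ, 0 < U ∧ ∃ δ ∈ Set.Ioo (0:ℝ) (1 / 2), ∃ a : ℝ, 0 < a ∧ ∃ J₀ : ℝ, 0 < J₀ ∧
      JosephsonGain U δ a J₀ ∧ Simplicity U δ := by
  -- (the conclusion is `JmCusp` unfolded once, cf. `JmCusp_iff_gain_and_simple`; it is not spelled `JmCusp` so that
  -- `JmCusp_of` stays the file's only theorem concluding the crux by name)
  obtain ⟨U, hU, δ, hδ, a', ha', hord, hS⟩ := h
  exact gain_and_simple_of_transfer ⟨U, hU, δ, hδ, a', ha', 1, one_pos, stub_orderGivesCusp U δ a' 1 hord, hS⟩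

/-! ### Normal form of the residual (lead c2, cycle 3)

The sibling crux `JmInterchange` (stmt-2227) has the SAME hypothesis as clause (i) of `JmCusp`, token by token, and
its leads landed both halves of the single-layer form of the window double:
`hypGivesZEPO_of_pigeonhole` (gain ⇒ zero-excess pair order; column pigeonhole on the positive minimiser) and
`zepoGivesHyp` (zero-excess pair order ⇒ gain; window trial pair).  Hence, with NO sorry:

* `josephsonGain_iff_zeroExcessPairOrder'` — clause (i) at `(U, δ)` ⇔ `ZeroExcessPairOrder U δ`;
* `gain_and_simple_iff_zepo_and_simple` — the crux (unfolded once) ⇔ `∃ (U, δ), ZeroExcessPairOrder ∧ Simplicity`;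
* `zepo_and_simple_of_core` — the open stub `stub_core` (C⁺) implies that normal form, and the normal form implies
  the crux: the residual of this line is the crux itself up to constants (`a ↦ a²/(8C²)`, `c ↦ c/4`), i.e.
  crux-sized by a theorem, not by opinion.

`ZeroExcessPairOrder U δ` is literally the antecedent of residue (R1) `stub_zepoReachesFloor` of the `JmInterchange`
line (`Cruxes/JmInterchange/Lines/Sketch.lean` §5; tree `jmInterchange_iff_reachesFloor_and_bridges`, p127245): the
two cruxes of the route share ONE open single-layer statement — zero-excess `d`-wave pair order of the doped
repulsive Hubbard torus at some / every `(U, δ)`.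
-/

open Literature.MathematicalPhysics.QuantumLattice in
/-- ZERO-EXCESS `d`-WAVE PAIR ORDER at `(U, δ)` (verbatim the hypothesis of residue (R1) of crux `JmInterchange`):
some `c > 0` such that for every `ε > 0`, eventually in even `L`, a unit vector of sector `N_L` or `N_L − 2`
(`S^z = 0`) lies within `εL²` of its sector floor and has `‖Δ_d v‖² ≥ cL⁴`. -/
def ZeroExcessPairOrder (U δ : ℝ) : Prop :=
  ∃ c : ℝ, 0 < c ∧ ∀ ε : ℝ, 0 < ε → ∃ L₀ : ℕ, ∀ (L : ℕ) [NeZero L], Even L → L₀ ≤ L →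
    ∃ n : ℕ, (n = 2 * ⌊(1 - δ) * (L : ℝ) ^ 2 / 2⌋₊ ∨ n = 2 * ⌊(1 - δ) * (L : ℝ) ^ 2 / 2⌋₊ - 2) ∧
      ∃ v : Fock (Orb (FermionTorus 2 L)), v ∈ szSector n 0 ∧ star v ⬝ᵥ v = 1 ∧
        (star v ⬝ᵥ (hubbardTorus 2 L 1 U *ᵥ v)).re ≤
            (hubbardTorus 2 L 1 U).minEnergyOn (szSector n 0) + ε * (L : ℝ) ^ 2 ∧
        c * (L : ℝ) ^ 4 ≤
          (star (pairField dWaveFormFactor L *ᵥ v) ⬝ᵥ (pairField dWaveFormFactor L *ᵥ v)).re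

/-- Clause (i) at `(U, δ)` (for some constants `a, J₀ > 0`) is EXACTLY zero-excess pair order at `(U, δ)`
(`hypGivesZEPO_of_pigeonhole` / `zepoGivesHyp` of the `JmInterchange` line; landed for this crux as
`Theorems.JosephsonMirror.josephsonGain_iff_zeroExcessPairOrder`). -/
theorem josephsonGain_iff_zeroExcessPairOrder' (U δ : ℝ) (hU : 0 < U) (hδ : δ ∈ Set.Ioo (0:ℝ) (1 / 2)) :
    (∃ a J₀ : ℝ, 0 < a ∧ 0 < J₀ ∧ JosephsonGain U δ a J₀) ↔ ZeroExcessPairOrder U δ := by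
  constructor
  · rintro ⟨a, J₀, ha, hJ₀, hG⟩
    exact _root_.Summit.HubbardSuperconductivity.HubbardSuperconductivity.Theorems.JosephsonMirror.hypGivesZEPO_of_pigeonhole
      (fun {ι} _ _ => _root_.Summit.HubbardSuperconductivity.HubbardSuperconductivity.Theorems.JosephsonMirror.windowPigeonhole)
      (fun {ι} _ _ => _root_.Summit.HubbardSuperconductivity.HubbardSuperconductivity.Theorems.JosephsonMirror.couplingExpectBound)
      U δ a J₀ hU hδ ha hJ₀ hG
  · intro hZ
    exact _root_.Summit.HubbardSuperconductivity.HubbardSuperconductivity.Theorems.JosephsonMirror.zepoGivesHyp U δ hU hδ hZ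

/-- THE CRUX IN NORMAL FORM (left side = `JmCusp` unfolded once, cf. `JmCusp_iff_gain_and_simple`; not spelled
`JmCusp` so that `JmCusp_of` stays the file's only theorem concluding the crux by name; the by-name statement is
landed as `Theorems.JosephsonMirror.jmCusp_iff_zeroExcessPairOrder_and_simple`). -/
theorem gain_and_simple_iff_zepo_and_simple :
    (∃ U : ℝ, 0 < U ∧ ∃ δ ∈ Set.Ioo (0:ℝ) (1 / 2), ∃ a : ℝ, 0 < a ∧ ∃ J₀ : ℝ, 0 < J₀ ∧
      JosephsonGain U δ a J₀ ∧ Simplicity U δ) ↔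
    ∃ U : ℝ, 0 < U ∧ ∃ δ ∈ Set.Ioo (0:ℝ) (1 / 2), ZeroExcessPairOrder U δ ∧ Simplicity U δ := by
  constructor
  · rintro ⟨U, hU, δ, hδ, a, ha, J₀, hJ₀, hG, hS⟩
    exact ⟨U, hU, δ, hδ, (josephsonGain_iff_zeroExcessPairOrder' U δ hU hδ).1 ⟨a, J₀, ha, hJ₀, hG⟩, hS⟩
  · rintro ⟨U, hU, δ, hδ, hZ, hS⟩
    obtain ⟨a, J₀, ha, hJ₀, hG⟩ := (josephsonGain_iff_zeroExcessPairOrder' U δ hU hδ).2 hZ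
    exact ⟨U, hU, δ, hδ, a, ha, J₀, hJ₀, hG, hS⟩

/-- THE RESIDUAL IS THE CRUX (up to constants): the open stub's statement C⁺ implies the normal form
(`stub_dedouble`, then `josephsonGain_iff_zeroExcessPairOrder'`), which is equivalent to the crux
(`gain_and_simple_iff_zepo_and_simple`).  Stated on the STATEMENT of `stub_core` as a hypothesis (no sorry in
this theorem's cone). -/
theorem zepo_and_simple_of_core
    (h : ∃ U : ℝ, 0 < U ∧ ∃ δ ∈ Set.Ioo (0:ℝ) (1 / 2), ∃ a' : ℝ, 0 < a' ∧ ∃ g₀ : ℝ, 0 < g₀ ∧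
      ZeroModeCusp U δ a' g₀ ∧ Simplicity U δ) :
    ∃ U : ℝ, 0 < U ∧ ∃ δ ∈ Set.Ioo (0:ℝ) (1 / 2), ZeroExcessPairOrder U δ ∧ Simplicity U δ :=
  gain_and_simple_iff_zepo_and_simple.1 (gain_and_simple_of_transfer h)

end Summit.HubbardSuperconductivity.HubbardSuperconductivity.Cruxes.JmCusp.Lines.Sketch
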